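import Summits.SmoothPoincare4.SmoothPoincare4.Theses.SymplecticOrigami
import Summits.SmoothPoincare4.SmoothPoincare4.Theorems.EuclideanOrigamiRoundCreaseStandardSheets
import Literature.Topology.FourManifolds.HomotopySpheres
import Literature.Topology.FourManifolds.SchoenfliesTools
import Literature.Topology.FourManifolds.ClosedBallSmoothEmbeddings
import Literature.Geometry.Symplectic.GromovMcDuffTwistedSphereProofs

/-!
# Stub `stub_roundCreaseStandard` of line `round-trace-continuity` for crux `OrigamiFoldExistence`
(item stmt-SmoothPoincare4-7844, route route-SmoothPoincare4-SymplecticOrigami)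

The registered stub (lead reshape r1), VERBATIM the support item `RoundCreaseStandard` of route
EuclideanOrigami (stmt-SmoothPoincare4-10644): under Cerf's `Γ₄ = 0` in twisted-sphere form (the
antecedent; the body of the named fact `Literature.Topology.FourManifolds.cerf_twistedSphere_four`),
a homotopy 4-sphere `S` carrying an immersed fake ball `(e, F)` whose crease lies in a round sphere
(`dist (F (e u)) c = r` for `‖u‖ = 1`) is diffeomorphic to `S⁴`.

Proof. By the helper files `EuclideanOrigamiRoundCreaseStandardCrease.lean` / `…Sheets.lean`:
`0 < r`, `F ∘ e` maps the unit sphere injectively onto `S_r(c)`, and `F` is injective on the fake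
ball `Δ = (e(B̊⁴))ᶜ` with `F(Δ) = B̄_r(c)` (sheet counting). Here:

* `exists_isOpen_injOn` — an injective local diffeomorphism on the compact `Δ` is an injective local
  diffeomorphism on an open `U ⊇ Δ` (generalised tube lemma applied to the set of pairs
  `{(x, x') | F x = F x' → x = x'}`, a neighbourhood of `Δ × Δ`);
* `exists_isTwistedSphere` — `Ψ = F|U` is a partial diffeomorphism `S ⇀ ℝ⁴` (Mathlib
  `OpenPartialHomeomorph.ofContinuousOpenRestrict`; its inverse is smooth, agreeing locally with the
  local inverses of `F`); the disc `b ↦ Ψ⁻¹ (c + r b)` is a smooth embedding of the manifold with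
  boundary `𝔻⁴` onto `Δ` (tree `Literature.Geometry.Symplectic.isSmoothEmbedding_comp_coe_closedBall`),
  the chart disc `a ↦ e a` one onto `e(B̄⁴)` (tree
  `isSmoothEmbedding_comp_coe_closedBall_of_injective_mfderiv`); they cover `S`, meet only in
  boundary points, and have the common boundary sphere `e(S³) = Ψ⁻¹(S_r(c))`, so `S = 𝔻⁴ ∪_φ 𝔻⁴`
  (tree `SchoenfliesTools.exists_isTwistedSphere`);
* `stub_roundCreaseStandard` — bundle `S` as a `TwistedSphere 3 φ` and apply the antecedent.

Everything is proved; no definitions, no named facts (Cerf's theorem enters only as the stub's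
antecedent).

References: J. Cerf, *Sur les difféomorphismes de la sphère de dimension trois (Γ₄ = 0)*, LNM 53
(1968) [Cerf1968]; M. Kervaire, J. Milnor, *Groups of homotopy spheres I*, Ann. Math. 77 (1963), §1
[KervaireMilnor1963]; R. Palais, *Extending diffeomorphisms*, Proc. AMS 11 (1960) [Palais1960];
J. Milnor, *Lectures on the h-cobordism theorem* (1965), §9 [MilnorHCobordism1965].
-/

noncomputable section

-- the prescribed namespace `Summit.<P>.<Sub>.…` duplicates `SmoothPoincare4` (P = Sub)
set_option linter.dupNamespace false

open scoped Manifold ContDiff Topology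
open Set Function Metric
open Literature.Topology.FourManifolds (HomotopySphere)

namespace Summit.SmoothPoincare4.SmoothPoincare4.Theorems.OrigamiFoldExistence.RoundTraceContinuity

open Summit.SmoothPoincare4.SmoothPoincare4.Theorems.EuclideanOrigami.RoundCreaseStandard

variable (S : HomotopySphere 4) {e : EuclideanSpace ℝ (Fin 4) → S.carrier} {F : S.carrier →
    (EuclideanSpace ℝ (Fin 4))}

/-- **An injective local diffeomorphism on a compact set is injective on a neighbourhood**: there is
an open `U ⊇ Δ_e` on which `F` is an injective local diffeomorphism (generalised tube lemma applied
to the open set of pairs `(x, x')` with `F x = F x' → x = x'`, which is a neighbourhood of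
`Δ_e × Δ_e` by local injectivity on the diagonal and by Hausdorffness off it). -/
theorem exists_isOpen_injOn (hE : Manifold.IsSmoothEmbedding (𝓡 4) (𝓡 4) ∞ e)
    (hF : ∀ x, x ∉ e '' ball (0 : EuclideanSpace ℝ (Fin 4)) 1 → IsLocalDiffeomorphAt (𝓡 4) (𝓡 4) ∞
        F x)
    {c : EuclideanSpace ℝ (Fin 4)} {r : ℝ} (hround : ∀ u : EuclideanSpace ℝ (Fin 4), ‖u‖ = 1 → dist
        (F (e u)) c = r) :
    ∃ U : Set S.carrier, IsOpen U ∧ (e '' ball (0 : EuclideanSpace ℝ (Fin 4)) 1)ᶜ ⊆ U ∧ InjOn F U ∧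
      ∀ x ∈ U, IsLocalDiffeomorphAt (𝓡 4) (𝓡 4) ∞ F x := by
  set Δ := (e '' ball (0 : EuclideanSpace ℝ (Fin 4)) 1)ᶜ with hΔ
  have hΔc : IsCompact Δ := (isOpen_image_ball S hE).isClosed_compl.isCompact
  have hinj : InjOn F Δ := injOn_compl_image_ball S hE hF hround
  set N : Set (S.carrier × S.carrier) := {q | F q.1 = F q.2 → q.1 = q.2} with hN
  have hNnhds : ∀ q ∈ Δ ×ˢ Δ, N ∈ 𝓝 q := by
    rintro ⟨x, x'⟩ ⟨hx, hx'⟩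
    by_cases hq : F x = F x'
    · have hxx' : x = x' := hinj hx hx' hq
      subst hxx'
      obtain ⟨Φ, hxΦ, heq⟩ := hF x hx
      refine Filter.mem_of_superset
        (prod_mem_nhds (Φ.open_source.mem_nhds hxΦ) (Φ.open_source.mem_nhds hxΦ)) ?_
      rintro ⟨y, y'⟩ ⟨hy, hy'⟩ hyy'
      exact Φ.injOn hy hy' (by rw [← heq hy, ← heq hy']; exact hyy')
    · obtain ⟨A, A', hA, hA', hxA, hxA', hAA'⟩ := t2_separation hq
      have h1 : F ⁻¹' A ∈ 𝓝 x :=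
        (hF x hx).contMDiffAt.continuousAt.preimage_mem_nhds (hA.mem_nhds hxA)
      have h2 : F ⁻¹' A' ∈ 𝓝 x' :=
        (hF x' hx').contMDiffAt.continuousAt.preimage_mem_nhds (hA'.mem_nhds hxA')
      refine Filter.mem_of_superset (prod_mem_nhds h1 h2) ?_
      rintro ⟨y, y'⟩ ⟨hy, hy'⟩ hyy'
      exact absurd hyy' (hAA'.ne_of_mem hy hy')
  obtain ⟨U₁, U₂, hU₁, hU₂, hΔU₁, hΔU₂, hprod⟩ :=
    generalized_tube_lemma hΔc hΔc isOpen_interior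
      (fun q hq => mem_interior_iff_mem_nhds.2 (hNnhds q hq))
  set O : Set S.carrier := {x | IsLocalDiffeomorphAt (𝓡 4) (𝓡 4) ∞ F x} with hO
  have hOopen : IsOpen O := by
    rw [isOpen_iff_forall_mem_open]
    rintro x ⟨Φ, hxΦ, heq⟩
    exact ⟨Φ.source, fun y hy => ⟨Φ, hy, heq⟩, Φ.open_source, hxΦ⟩
  refine ⟨U₁ ∩ U₂ ∩ O, (hU₁.inter hU₂).inter hOopen,
    fun x hx => ⟨⟨hΔU₁ hx, hΔU₂ hx⟩, hF x hx⟩, ?_, fun x hx => hx.2⟩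
  rintro x ⟨⟨hx₁, -⟩, -⟩ x' ⟨⟨-, hx'₂⟩, -⟩ hxx'
  exact interior_subset (hprod (mk_mem_prod hx₁ hx'₂)) hxx'

/-- **A homotopy 4-sphere carrying an immersed fake ball with round crease is a twisted sphere.**
With `U` as in `exists_isOpen_injOn`, `Ψ = F|U` is a partial diffeomorphism `S ⇀ ℝ⁴` whose target
contains `F(Δ_e) = B̄_r(c)`; the disc `b ↦ Ψ⁻¹ (c + r b)` is a smooth embedding of `𝔻⁴` onto `Δ_e`
(tree `isSmoothEmbedding_comp_coe_closedBall`), the chart disc `a ↦ e a` is a smooth embedding of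
`𝔻⁴` onto `e(B̄⁴)`, the two cover `S`, meet only along boundary points and have the same boundary
sphere `e(S³) = Ψ⁻¹(S_r(c))`; hence `S = 𝔻⁴ ∪_φ 𝔻⁴` (tree `SchoenfliesTools.exists_isTwistedSphere`).
Kervaire–Milnor 1963 §1; Milnor 1965 §9; Palais 1960. -/
theorem exists_isTwistedSphere (hE : Manifold.IsSmoothEmbedding (𝓡 4) (𝓡 4) ∞ e)
    (hF : ∀ x, x ∉ e '' ball (0 : EuclideanSpace ℝ (Fin 4)) 1 → IsLocalDiffeomorphAt (𝓡 4) (𝓡 4) ∞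
        F x)
    {c : EuclideanSpace ℝ (Fin 4)} {r : ℝ} (hround : ∀ u : EuclideanSpace ℝ (Fin 4), ‖u‖ = 1 → dist
        (F (e u)) c = r) :
    ∃ φ : (Metric.sphere (0 : EuclideanSpace ℝ (Fin 4)) 1) ≃ₘ⟮𝓡 3, 𝓡 3⟯ (Metric.sphere (0 :
        EuclideanSpace ℝ (Fin 4)) 1), Literature.Topology.FourManifolds.IsTwistedSphere 3 φ
        S.carrier := by
  have hr := radius_pos S hE hF hround
  obtain ⟨-, himS⟩ := injOn_comp_sphere S hE hF hround
  have himΔ := image_compl_image_ball_eq S hE hF hround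
  obtain ⟨U, hUopen, hΔU, hinjU, hlocU⟩ := exists_isOpen_injOn S hE hF hround
  set Δ := (e '' ball (0 : EuclideanSpace ℝ (Fin 4)) 1)ᶜ with hΔ
  haveI : Nonempty S.carrier := ⟨e 0⟩
  -- the partial diffeomorphism `Ψ = F|U`
  have hcontU : ContinuousOn F U := fun x hx =>
    (hlocU x hx).contMDiffAt.continuousAt.continuousWithinAt
  have hlocHU : IsLocalHomeomorph (U.restrict F) :=
    isLocalHomeomorph_restrict hUopen
      (IsLocalDiffeomorphOn.isLocalHomeomorphOn (I := 𝓡 4) (J := 𝓡 4) (n := ∞)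
        fun x : U => hlocU x x.2)
  set Ψ : OpenPartialHomeomorph S.carrier (EuclideanSpace ℝ (Fin 4)) :=
    OpenPartialHomeomorph.ofContinuousOpenRestrict (hinjU.toPartialEquiv F U) hcontU
      hlocHU.isOpenMap hUopen with hΨdef
  have hΨsource : Ψ.source = U := rfl
  have hΨtarget : Ψ.target = F '' U := rfl
  have hΨapply : ∀ x, Ψ x = F x := fun x => rfl
  have hΨsm : ContMDiffOn (𝓡 4) 𝓘(ℝ, (EuclideanSpace ℝ (Fin 4))) ∞ Ψ Ψ.source := fun x hx =>
    (hlocU x hx).contMDiffAt.contMDiffWithinAt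
  have hΨsymm : ContMDiffOn 𝓘(ℝ, (EuclideanSpace ℝ (Fin 4))) (𝓡 4) ∞ Ψ.symm Ψ.target := by
    intro y hy
    rw [hΨtarget] at hy
    obtain ⟨x, hx, rfl⟩ := hy
    apply ContMDiffAt.contMDiffWithinAt
    have hx' := hlocU x hx
    refine hx'.localInverse_contMDiffAt.congr_of_eventuallyEq ?_
    have hopen : IsOpen (hx'.localInverse.source ∩ hx'.localInverse ⁻¹' U) :=
      hx'.localInverse.contMDiffOn.continuousOn.isOpen_inter_preimage hx'.localInverse.open_source
        hUopen
    have hmem : F x ∈ hx'.localInverse.source ∩ hx'.localInverse ⁻¹' U := by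
      refine ⟨hx'.localInverse_mem_source, ?_⟩
      show hx'.localInverse (F x) ∈ U
      rw [hx'.localInverse_left_inv hx'.localInverse_mem_target]
      exact hx
    filter_upwards [hopen.mem_nhds hmem] with y hy
    obtain ⟨hy₁, hy₂⟩ := hy
    have h1 : F (hx'.localInverse y) = y := hx'.localInverse_right_inv hy₁
    have h2 : Ψ.symm (Ψ (hx'.localInverse y)) = hx'.localInverse y := Ψ.left_inv hy₂
    rwa [hΨapply, h1] at h2
  -- the affine chart `T y = c + r • y` of `ℝ⁴`
  let T : (EuclideanSpace ℝ (Fin 4)) ≃ₘ⟮𝓡 4, 𝓡 4⟯ (EuclideanSpace ℝ (Fin 4)) :=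
    { toFun := fun y => c + r • y
      invFun := fun z => r⁻¹ • (z - c)
      left_inv := fun y => by simp [smul_smul, hr.ne']
      right_inv := fun z => by simp [smul_smul, hr.ne']
      contMDiff_toFun := (contDiff_const.add (contDiff_id.const_smul r)).contMDiff
      contMDiff_invFun := ((contDiff_id.sub contDiff_const).const_smul r⁻¹).contMDiff }
  have hTapply : ∀ y : EuclideanSpace ℝ (Fin 4), T y = c + r • y := fun y => rfl
  -- the disc `g = Ψ⁻¹ ∘ T`
  set g : OpenPartialHomeomorph (EuclideanSpace ℝ (Fin 4)) S.carrier :=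
      T.toHomeomorph.toOpenPartialHomeomorph.trans Ψ.symm
    with hgdef
  have hgapply : ∀ y : EuclideanSpace ℝ (Fin 4), g y = Ψ.symm (c + r • y) := fun y => rfl
  have hTball : ∀ y : EuclideanSpace ℝ (Fin 4), y ∈ closedBall (0 : EuclideanSpace ℝ (Fin 4)) 1 → c
      + r • y ∈ F '' Δ := by
    intro y hy
    rw [himΔ, mem_closedBall, dist_eq_norm, add_sub_cancel_left, norm_smul, Real.norm_of_nonneg
        hr.le]
    exact mul_le_of_le_one_right hr.le (mem_closedBall_zero_iff.1 hy)
  have hsub : closedBall (0 : EuclideanSpace ℝ (Fin 4)) 1 ⊆ g.source := by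
    intro y hy
    rw [hgdef, OpenPartialHomeomorph.trans_source]
    refine ⟨mem_univ _, ?_⟩
    show T y ∈ Ψ.symm.source
    rw [OpenPartialHomeomorph.symm_source, hΨtarget, hTapply]
    exact image_mono hΔU (hTball y hy)
  have hg : ContMDiffOn 𝓘(ℝ, (EuclideanSpace ℝ (Fin 4))) (𝓡 4) ∞ g g.source := by
    refine (hΨsymm.comp T.contMDiff.contMDiffOn ?_ : ContMDiffOn _ _ _ (Ψ.symm ∘ T) g.source)
    intro y hy
    rw [hgdef, OpenPartialHomeomorph.trans_source] at hy
    exact hy.2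
  have hg' : ContMDiffOn (𝓡 4) 𝓘(ℝ, (EuclideanSpace ℝ (Fin 4))) ∞ g.symm g.target := by
    refine (T.symm.contMDiff.comp_contMDiffOn (hΨsm.mono ?_) :
      ContMDiffOn _ _ _ (T.symm ∘ Ψ) g.target)
    intro x hx
    rw [hgdef, OpenPartialHomeomorph.trans_target] at hx
    exact hx.1
  have hB := Literature.Geometry.Symplectic.isSmoothEmbedding_comp_coe_closedBall g hg hg' hsub
  -- the chart disc
  have hEloc := hE.isLocalDiffeomorph_of_finrank_eq rfl
  have hA := Literature.Topology.FourManifolds.isSmoothEmbedding_comp_coe_closedBall_of_injective_mfderiv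
    (n := 3) (m := 4) hE.contMDiff hE.isEmbedding.injective.injOn (fun y _ a b hab =>
      ((hEloc y).mfderivToContinuousLinearEquiv (by simp)).injective hab)
  -- `Ψ⁻¹ (F x) = x` on `Δ`
  have hΨF : ∀ x ∈ Δ, Ψ.symm (F x) = x := fun x hx => Ψ.left_inv (hΔU hx)
  have hsmul : ∀ z : EuclideanSpace ℝ (Fin 4), c + r • (r⁻¹ • (z - c)) = z := fun z => by
    rw [smul_smul, mul_inv_cancel₀ hr.ne', one_smul]
    abel
  refine Literature.Topology.FourManifolds.SchoenfliesTools.exists_isTwistedSphere hA hB ?_ ?_ ?_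
  · -- the two discs cover `S`
    apply eq_univ_of_forall
    intro x
    by_cases hx : x ∈ e '' closedBall (0 : EuclideanSpace ℝ (Fin 4)) 1
    · obtain ⟨a, ha, rfl⟩ := hx
      exact Or.inl ⟨⟨a, ha⟩, rfl⟩
    · right
      have hxΔ : x ∈ Δ := compl_image_closedBall_subset S hx
      have hFx : F x ∈ closedBall c r := himΔ ▸ mem_image_of_mem F hxΔ
      refine ⟨⟨r⁻¹ • (F x - c), ?_⟩, ?_⟩
      · rw [mem_closedBall_zero_iff, norm_smul, norm_inv, Real.norm_of_nonneg hr.le, ← dist_eq_norm]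
        rw [inv_mul_le_iff₀ hr, mul_one]
        exact mem_closedBall.1 hFx
      · show g _ = x
        rw [hgapply, hsmul]
        exact hΨF x hxΔ
  · -- they meet along boundary points only
    intro a b hab
    change e a = g b at hab
    rw [hgapply] at hab
    obtain ⟨x', hx'Δ, hx'⟩ := hTball b b.2
    have hea : e a = x' := by
      rw [hab, ← hx']
      exact hΨF x' hx'Δ
    have ha1 : ‖(a : EuclideanSpace ℝ (Fin 4))‖ = 1 := by
      have h1 : e (a : EuclideanSpace ℝ (Fin 4)) ∉ e '' ball (0 : EuclideanSpace ℝ (Fin 4)) 1 :=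
          hea ▸ hx'Δ
      have hna : ¬ ‖(a : EuclideanSpace ℝ (Fin 4))‖ < 1 := fun h => h1 ⟨a, mem_ball_zero_iff.2 h,
          rfl⟩
      exact le_antisymm (mem_closedBall_zero_iff.1 a.2) (not_lt.1 hna)
    refine ⟨ha1, ?_⟩
    have hFa : dist (F (e a)) c = r := hround a ha1
    rw [hea, hx', dist_eq_norm, add_sub_cancel_left, norm_smul, Real.norm_of_nonneg hr.le] at hFa
    have : r * ‖(b : EuclideanSpace ℝ (Fin 4))‖ = r * 1 := by rw [hFa, mul_one]
    exact mul_left_cancel₀ hr.ne' this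
  · -- the boundary spheres agree
    ext x
    constructor
    · rintro ⟨z, rfl⟩
      have hz1 : ‖((z : (Metric.sphere (0 : EuclideanSpace ℝ (Fin 4)) 1)) : EuclideanSpace ℝ
          (Fin 4))‖ = 1 := norm_eq_of_mem_sphere z
      have hFz : dist (F (e z)) c = r := hround z hz1
      refine ⟨⟨r⁻¹ • (F (e z) - c), ?_⟩, ?_⟩
      · rw [mem_sphere_zero_iff_norm, norm_smul, norm_inv, Real.norm_of_nonneg hr.le, ←
          dist_eq_norm,
          hFz, inv_mul_cancel₀ hr.ne']
      · show g _ = e z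
        rw [hgapply, hsmul]
        exact hΨF _ (image_sphere_subset S hE ⟨z, z.2, rfl⟩)
    · rintro ⟨w, rfl⟩
      have hw : c + r • ((w : (Metric.sphere (0 : EuclideanSpace ℝ (Fin 4)) 1)) : EuclideanSpace ℝ
          (Fin 4)) ∈ sphere c r := by
        rw [mem_sphere, dist_eq_norm, add_sub_cancel_left, norm_smul, Real.norm_of_nonneg hr.le,
          norm_eq_of_mem_sphere w, mul_one]
      rw [← himS] at hw
      obtain ⟨z, hz, hzw⟩ := hw
      refine ⟨⟨z, hz⟩, ?_⟩
      show e z = g w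
      rw [hgapply, ← show F (e z) = c + r • ((w : (Metric.sphere (0 : EuclideanSpace ℝ (Fin 4)) 1))
          : EuclideanSpace ℝ (Fin 4)) from hzw]
      exact (hΨF _ (image_sphere_subset S hE ⟨z, hz, rfl⟩)).symm

/-- **Stub `stub_roundCreaseStandard` (round crease ⇒ standard, under Γ₄ = 0)** — lead reshape r1:
VERBATIM route EuclideanOrigami's support item `RoundCreaseStandard` (stmt-SmoothPoincare4-10644).  Under
Cerf's theorem in twisted-sphere form (the antecedent, = the body of the route item `CerfGammaFour` /
the named fact `Literature.Topology.FourManifolds.cerf_twistedSphere_four`): if some immersed fake ball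
`(e, F)` of a homotopy 4-sphere `S` has its crease inside a round sphere (`dist (F (e u)) c = r` for
`‖u‖ = 1`), then `r > 0`, `F ∘ e|S³` covers the round `S³` hence is injective, `F` is injective on
`Δ_e` with image the closed round ball (covering lemma), `Δ_e ≅ D⁴` compatibly with `e`, `S` is a
twisted sphere (`exists_isTwistedSphere`) and `S ≅ S⁴` by the antecedent.  Cerf 1968; Palais 1960;
Kervaire–Milnor 1963. -/
theorem stub_roundCreaseStandard :
    (∀ [Fact (Literature.Topology.FourManifolds.isSmoothEmbedding_sphereInclusion' 3)] (φ : (Metric.sphere (0 : EuclideanSpace ℝ (Fin 4)) 1) ≃ₘ⟮𝓡 3, 𝓡 3⟯ (Metric.sphere (0 : EuclideanSpace ℝ (Fin 4)) 1)) (T : Literature.Topology.FourManifolds.TwistedSphere 3 φ), Nonempty (T.carrier ≃ₘ⟮𝓡 4, 𝓡 4⟯ Metric.sphere (0 : EuclideanSpace ℝ (Fin 5)) 1)) → ∀ (S : Literature.Topology.FourManifolds.HomotopySphere 4) (e : EuclideanSpace ℝ (Fin 4) → S.carrier) (F : S.carrier → EuclideanSpace ℝ (Fin 4)), Manifold.IsSmoothEmbedding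 (𝓡 4) (𝓡 4) ∞ e → (∀ x, x ∉ e '' Metric.ball (0 : EuclideanSpace ℝ (Fin 4)) 1 → IsLocalDiffeomorphAt (𝓡 4) (𝓡 4) ∞ F x) → (∃ (c : EuclideanSpace ℝ (Fin 4)) (r : ℝ), ∀ u : EuclideanSpace ℝ (Fin 4), ‖u‖ = 1 → dist (F (e u)) c = r) → Nonempty (S.carrier ≃ₘ⟮𝓡 4, 𝓡 4⟯ Metric.sphere (0 : EuclideanSpace ℝ (Fin 5)) 1) := by
  intro hC S e F hE hF hround
  obtain ⟨c, r, hround⟩ := hround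
  obtain ⟨φ, hφ⟩ := exists_isTwistedSphere S hE hF hround
  exact hC φ ⟨S.carrier, hφ⟩

end Summit.SmoothPoincare4.SmoothPoincare4.Theorems.OrigamiFoldExistence.RoundTraceContinuity

end
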